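import Summits.ValiantsHypothesis.ValiantsHypothesis.Theorems.BarrierLeverChowThinRowsScaledForms

/-!
# Route BarrierLever — item `ChowHitsThinRowPartitionMinors` (stmt-ValiantsHypothesis-20195):
# choice of the scale `ε` and invertibility of the leave-one-out matrix on ARBITRARY columns
# (prelims for the all-columns first-order-rows slice, III)

Helper file (`--supports stmt-ValiantsHypothesis-20195`; cell valiant-natproofs, rung V4, 𝒟-side of
door (c); prover seat val-np-p7 gen 4).  Closes NO item; imports only `…ChowThinRowsScaledForms`
(val-np-p7 g4; hence only val-np-p4 / prover-g10 infrastructure, no route file); no definitions.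
Setting (memo MEMO-CPM-s1-UDC-v6 §3): columns `w : Fin r → Finset (Fin h)`, a family `U` (the
down-closed monomial basis of `…ChowThinRowsMonomialBasis`), a Finset `PT` of index sets containing
every singleton, and the SCALED INDICATOR FORMS `φ⁰_V = 1 + Σ_c γ_s(V)(c) y_c`,
`γ_s(V)(c) = (if |V| ≤ 1 then 1 else s)·[c ∈ V]`; `b_s(W') = coeff_{y^{W'}} ∏_{V∈PT} φ⁰_V`,
`B̃_s[i,j] = [U i ⊆ w j]·b_s(w j ∖ U i)`.
* `coeff_empty_prod_singletonForms` — at `s = 0` only the forms `1 + y_c` carry `y`'s: `b_0 ≡ 1`;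
* `exists_good_scale` — some `s ≠ 0` has `det B̃_s ≠ 0` and all `b_s(w j) ≠ 0` when
  `det [U i ⊆ w j] ≠ 0` (entries polynomial in `s` via the coefficient ring `ℂ[X]` and
  `MvPolynomial.map (Polynomial.evalRingHom s)`; `B̃_0 = [U i ⊆ w j]`; a nonzero polynomial has a non-root);
* `leaveOneOut_vecMul_injective` — for such `s`, `U` injective and down-closed inside `PT`, the
  leave-one-out vectors `(coeff_{y^{w j}} ∏_{PT ∖ U i} φ⁰)_j` are linearly independent
  (`ℰ = T·B̃_s`, `T[i,i'] = t_{U i}(U i')` triangular in `⊆` with nonzero diagonal).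

WHAT THIS IS NOT: nothing on items 20195 / 20172 / 19717 themselves, on crux
stmt-ValiantsHypothesis-14610, or on `VP` versus `VNP`.
-/
set_option linter.dupNamespace false

namespace Summit.ValiantsHypothesis.ValiantsHypothesis.Theorems.BarrierLever.ChowThinAll

open Finset MvPolynomial
open Summit.ValiantsHypothesis.ValiantsHypothesis.Theorems.BarrierLever.ChowFactor
  (coeff_partitionExpo_mul_affine coeff_partitionExpo_mul_yOnly totalDegree_affine_le)
open Summit.ValiantsHypothesis.ValiantsHypothesis.Theorems.BarrierLever.ProductStateSums
  (castAdd_ne_natAdd partitionExpo_apply_castAdd partitionExpo_apply_natAdd)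
open Summit.ValiantsHypothesis.ValiantsHypothesis.Theorems.BarrierLever.CorankRepair (partitionExpo_eq_iff)

variable {h r : ℕ}

/-! ## 1. The product at scale `0`: only singleton forms -/

/-- **At scale `0` the `x`-free coefficients are indicators**: if every form `φ⁰_V`, `V ∈ 𝒦`, has
`y`-coefficients `γ V c = [V = {c}]` (singleton forms `1 + y_c`, all other forms constant), then
`coeff (E ∅ W) ∏_𝒦 φ⁰ = [∀ c ∈ W, {c} ∈ 𝒦]`. -/
theorem coeff_empty_prod_singletonForms (γ : Finset (Fin h) → Fin h → ℂ)
    (𝒦 : Finset (Finset (Fin h))) (hγ : ∀ V ∈ 𝒦, ∀ c, γ V c = if V = {c} then 1 else 0)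
    (W : Finset (Fin h)) :
    coeff (∑ a ∈ (∅ : Finset (Fin h)), Finsupp.single (Fin.castAdd h a) 1 +
        ∑ c ∈ W, Finsupp.single (Fin.natAdd h c) 1)
        (∏ V ∈ 𝒦, (C 1 + ∑ a, C ((fun (_ : Fin h) (_ : Finset (Fin h)) => (0 : ℂ)) a V) *
            X (Fin.castAdd h a) + ∑ c, C (γ V c) * X (Fin.natAdd h c))) =
      if (∀ c ∈ W, ({c} : Finset (Fin h)) ∈ 𝒦) then 1 else 0 := by
  classical
  induction 𝒦 using Finset.induction_on generalizing W with
  | empty =>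
    rw [Finset.prod_empty, coeff_one]
    by_cases hW : W = ∅
    · subst hW
      simp
    · obtain ⟨c₀, hc₀⟩ := Finset.nonempty_iff_ne_empty.mpr hW
      have hne : ¬ ((0 : Fin (h + h) →₀ ℕ) = ∑ a ∈ (∅ : Finset (Fin h)), Finsupp.single (Fin.castAdd h a) 1 +
          ∑ c ∈ W, Finsupp.single (Fin.natAdd h c) 1) := by
        intro e
        have e' := (partitionExpo_eq_iff ∅ ∅ ∅ W).mp (by simpa using e)
        exact hW e'.2.symm
      rw [if_neg hne, if_neg (fun hall => absurd (hall c₀ hc₀) (Finset.notMem_empty _))]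
  | insert V 𝒦 hV ih =>
    have hγ𝒦 : ∀ V' ∈ 𝒦, ∀ c, γ V' c = if V' = {c} then 1 else 0 :=
      fun V' hV' c => hγ V' (Finset.mem_insert_of_mem hV') c
    have hγV : ∀ c, γ V c = if V = {c} then 1 else 0 := fun c => hγ V (Finset.mem_insert_self _ _) c
    rw [Finset.prod_insert hV, mul_comm, coeff_empty_mul_formG, ih hγ𝒦]
    simp only [ih hγ𝒦]
    by_cases hsing : ∃ c₀, V = {c₀}
    · obtain ⟨c₀, rfl⟩ := hsing
      have hterm : ∀ c ∈ W, (γ {c₀} c * if (∀ c' ∈ W.erase c, ({c'} : Finset (Fin h)) ∈ 𝒦) then (1 : ℂ) else 0) =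
          if c = c₀ then (if (∀ c' ∈ W.erase c₀, ({c'} : Finset (Fin h)) ∈ 𝒦) then (1 : ℂ) else 0) else 0 := by
        intro c _
        rw [hγV c]
        by_cases hcc : c = c₀
        · subst hcc
          simp
        · have hne : ({c₀} : Finset (Fin h)) ≠ {c} := fun e => hcc (Finset.singleton_injective e).symm
          rw [if_neg hne, if_neg hcc, zero_mul]
      rw [Finset.sum_congr rfl hterm, Finset.sum_ite_eq']
      by_cases hc₀W : c₀ ∈ W
      · rw [if_pos hc₀W]
        have h1 : ¬ (∀ c ∈ W, ({c} : Finset (Fin h)) ∈ 𝒦) := fun hall => hV (hall c₀ hc₀W)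
        rw [if_neg h1, zero_add]
        have hiff : (∀ c' ∈ W.erase c₀, ({c'} : Finset (Fin h)) ∈ 𝒦) ↔
            (∀ c ∈ W, ({c} : Finset (Fin h)) ∈ insert {c₀} 𝒦) := by
          constructor
          · intro hall c hc
            by_cases hcc : c = c₀
            · subst hcc; exact Finset.mem_insert_self _ _
            · exact Finset.mem_insert_of_mem (hall c (Finset.mem_erase.mpr ⟨hcc, hc⟩))
          · intro hall c' hc'
            rw [Finset.mem_erase] at hc'
            rcases Finset.mem_insert.mp (hall c' hc'.2) with e | e
            · exact absurd (Finset.singleton_injective e) hc'.1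
            · exact e
        simp only [hiff]
      · rw [if_neg hc₀W, add_zero]
        have hiff : (∀ c ∈ W, ({c} : Finset (Fin h)) ∈ 𝒦) ↔
            (∀ c ∈ W, ({c} : Finset (Fin h)) ∈ insert {c₀} 𝒦) :=
          ⟨fun hall c hc => Finset.mem_insert_of_mem (hall c hc), fun hall c hc =>
            (Finset.mem_insert.mp (hall c hc)).resolve_left
              fun e => hc₀W ((Finset.singleton_injective e) ▸ hc)⟩
        simp only [hiff]
    · have hγ0 : ∀ c, γ V c = 0 := fun c => by rw [hγV c, if_neg (fun e => hsing ⟨c, e⟩)]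
      simp only [hγ0, zero_mul, Finset.sum_const_zero, add_zero]
      have hiff : (∀ c ∈ W, ({c} : Finset (Fin h)) ∈ 𝒦) ↔
          (∀ c ∈ W, ({c} : Finset (Fin h)) ∈ insert V 𝒦) :=
        ⟨fun hall c hc => Finset.mem_insert_of_mem (hall c hc), fun hall c hc =>
          (Finset.mem_insert.mp (hall c hc)).resolve_left fun e => hsing ⟨c, e.symm⟩⟩
      simp only [hiff]

/-! ## 2. Choice of the scale -/

/-- The scaled indicator coefficients at `s = 0` are the singleton indicators. -/
theorem scaledCoeff_zero (V : Finset (Fin h)) (c : Fin h) :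
    ((if V.card ≤ 1 then (1 : ℂ) else 0) * (if c ∈ V then 1 else 0)) =
      if V = {c} then 1 else 0 := by
  by_cases hV : V = {c}
  · subst hV; simp
  · rw [if_neg hV]
    by_cases hc : c ∈ V
    · have hcard : ¬ V.card ≤ 1 := by
        intro hle
        apply hV
        have hpos : 0 < V.card := Finset.card_pos.mpr ⟨c, hc⟩
        obtain ⟨x, hx⟩ := Finset.card_eq_one.mp (le_antisymm hle hpos)
        rw [hx] at hc
        rw [hx, Finset.mem_singleton.mp hc]
      rw [if_neg hcard, zero_mul]
    · rw [if_neg hc, mul_zero]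

/-- **Choice of the scale.**  If every singleton is in `PT` and the `0/1` matrix `[U i ⊆ w j]` is
nonsingular, then for some `s ≠ 0` the matrix `B̃_s[i,j] = [U i ⊆ w j] · b_s(w j ∖ U i)` is nonsingular
and every `b_s(w j)` is nonzero, where `b_s(W') = coeff_{y^{W'}} ∏_{V ∈ PT} (1 + Σ_c γ_s(V)(c) y_c)`,
`γ_s(V)(c) = (if |V| ≤ 1 then 1 else s) · [c ∈ V]`.  (Polynomial dependence on `s` via the coefficient
ring `ℂ[X]`; at `s = 0`, `B̃_0 = [U i ⊆ w j]` and `b_0 ≡ 1`.) -/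
theorem exists_good_scale (U w : Fin r → Finset (Fin h)) (PT : Finset (Finset (Fin h)))
    (hsing : ∀ c : Fin h, ({c} : Finset (Fin h)) ∈ PT)
    (hZ : (Matrix.of fun i j : Fin r => if U i ⊆ w j then (1 : ℂ) else 0).det ≠ 0) :
    ∃ s : ℂ, s ≠ 0 ∧
      (Matrix.of fun i j : Fin r => if U i ⊆ w j then
        coeff (∑ a ∈ (∅ : Finset (Fin h)), Finsupp.single (Fin.castAdd h a) 1 +
            ∑ c ∈ w j \ U i, Finsupp.single (Fin.natAdd h c) 1)
          (∏ V ∈ PT, (C 1 + ∑ a, C ((fun (_ : Fin h) (_ : Finset (Fin h)) => (0 : ℂ)) a V) *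
              X (Fin.castAdd h a) +
            ∑ c, C ((if V.card ≤ 1 then (1 : ℂ) else s) * (if c ∈ V then 1 else 0)) * X (Fin.natAdd h c)))
        else 0).det ≠ 0 ∧
      ∀ j, coeff (∑ a ∈ (∅ : Finset (Fin h)), Finsupp.single (Fin.castAdd h a) 1 +
            ∑ c ∈ w j, Finsupp.single (Fin.natAdd h c) 1)
          (∏ V ∈ PT, (C 1 + ∑ a, C ((fun (_ : Fin h) (_ : Finset (Fin h)) => (0 : ℂ)) a V) *
              X (Fin.castAdd h a) +
            ∑ c, C ((if V.card ≤ 1 then (1 : ℂ) else s) * (if c ∈ V then 1 else 0)) *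
              X (Fin.natAdd h c))) ≠ 0 := by
  classical
  -- the product over the coefficient ring `ℂ[X]`
  set BX : MvPolynomial (Fin (h + h)) (Polynomial ℂ) :=
    ∏ V ∈ PT, (C 1 + ∑ a, C ((fun (_ : Fin h) (_ : Finset (Fin h)) => (0 : Polynomial ℂ)) a V) *
        X (Fin.castAdd h a) +
      ∑ c, C ((if V.card ≤ 1 then (1 : Polynomial ℂ) else Polynomial.X) *
        (if c ∈ V then 1 else 0)) * X (Fin.natAdd h c)) with hBX
  set bX : Finset (Fin h) → Polynomial ℂ := fun W' =>
    coeff (∑ a ∈ (∅ : Finset (Fin h)), Finsupp.single (Fin.castAdd h a) 1 +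
      ∑ c ∈ W', Finsupp.single (Fin.natAdd h c) 1) BX with hbX
  -- specialisation `X ↦ s`
  have hmap : ∀ s : ℂ, MvPolynomial.map (Polynomial.evalRingHom s) BX =
      ∏ V ∈ PT, (C 1 + ∑ a, C ((fun (_ : Fin h) (_ : Finset (Fin h)) => (0 : ℂ)) a V) *
          X (Fin.castAdd h a) +
        ∑ c, C ((if V.card ≤ 1 then (1 : ℂ) else s) * (if c ∈ V then 1 else 0)) * X (Fin.natAdd h c)) := by
    intro s
    rw [hBX, map_prod]
    refine Finset.prod_congr rfl fun V _ => ?_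
    simp only [map_add, map_sum, map_mul, MvPolynomial.map_C, MvPolynomial.map_X,
      Polynomial.coe_evalRingHom, Polynomial.eval_one, Polynomial.eval_zero,
      apply_ite (Polynomial.eval s), Polynomial.eval_X]
  have hb : ∀ (s : ℂ) (W' : Finset (Fin h)),
      coeff (∑ a ∈ (∅ : Finset (Fin h)), Finsupp.single (Fin.castAdd h a) 1 +
          ∑ c ∈ W', Finsupp.single (Fin.natAdd h c) 1)
        (∏ V ∈ PT, (C 1 + ∑ a, C ((fun (_ : Fin h) (_ : Finset (Fin h)) => (0 : ℂ)) a V) *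
            X (Fin.castAdd h a) +
          ∑ c, C ((if V.card ≤ 1 then (1 : ℂ) else s) * (if c ∈ V then 1 else 0)) * X (Fin.natAdd h c))) =
        Polynomial.eval s (bX W') := by
    intro s W'
    rw [← hmap s, MvPolynomial.coeff_map]
    rfl
  -- the matrix over `ℂ[X]`
  set MX : Matrix (Fin r) (Fin r) (Polynomial ℂ) :=
    Matrix.of fun i j => if U i ⊆ w j then bX (w j \ U i) else 0 with hMX
  have hdet : ∀ s : ℂ, (Matrix.of fun i j : Fin r => if U i ⊆ w j then
        coeff (∑ a ∈ (∅ : Finset (Fin h)), Finsupp.single (Fin.castAdd h a) 1 +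
            ∑ c ∈ w j \ U i, Finsupp.single (Fin.natAdd h c) 1)
          (∏ V ∈ PT, (C 1 + ∑ a, C ((fun (_ : Fin h) (_ : Finset (Fin h)) => (0 : ℂ)) a V) *
              X (Fin.castAdd h a) +
            ∑ c, C ((if V.card ≤ 1 then (1 : ℂ) else s) * (if c ∈ V then 1 else 0)) * X (Fin.natAdd h c)))
        else 0).det = Polynomial.eval s MX.det := by
    intro s
    have e : (Matrix.of fun i j : Fin r => if U i ⊆ w j then
        coeff (∑ a ∈ (∅ : Finset (Fin h)), Finsupp.single (Fin.castAdd h a) 1 +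
            ∑ c ∈ w j \ U i, Finsupp.single (Fin.natAdd h c) 1)
          (∏ V ∈ PT, (C 1 + ∑ a, C ((fun (_ : Fin h) (_ : Finset (Fin h)) => (0 : ℂ)) a V) *
              X (Fin.castAdd h a) +
            ∑ c, C ((if V.card ≤ 1 then (1 : ℂ) else s) * (if c ∈ V then 1 else 0)) * X (Fin.natAdd h c)))
        else 0) = (Polynomial.evalRingHom s).mapMatrix MX := by
      ext i j
      rw [RingHom.mapMatrix_apply, Matrix.map_apply, hMX, Matrix.of_apply, Matrix.of_apply]
      by_cases hij : U i ⊆ w j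
      · rw [if_pos hij, if_pos hij, hb]
        rfl
      · rw [if_neg hij, if_neg hij, map_zero]
    rw [e, ← RingHom.map_det]
    rfl
  -- at `s = 0`: `b_0 ≡ 1`, `B̃_0 = Z`
  have hb0 : ∀ W' : Finset (Fin h), Polynomial.eval 0 (bX W') = 1 := by
    intro W'
    rw [← hb 0 W']
    rw [coeff_empty_prod_singletonForms (fun V c => (if V.card ≤ 1 then (1 : ℂ) else 0) *
      (if c ∈ V then 1 else 0)) PT (fun V _ c => scaledCoeff_zero V c) W']
    rw [if_pos (fun c _ => hsing c)]
  have hdet0 : Polynomial.eval 0 MX.det ≠ 0 := by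
    rw [← hdet 0]
    have e : (Matrix.of fun i j : Fin r => if U i ⊆ w j then
        coeff (∑ a ∈ (∅ : Finset (Fin h)), Finsupp.single (Fin.castAdd h a) 1 +
            ∑ c ∈ w j \ U i, Finsupp.single (Fin.natAdd h c) 1)
          (∏ V ∈ PT, (C 1 + ∑ a, C ((fun (_ : Fin h) (_ : Finset (Fin h)) => (0 : ℂ)) a V) *
              X (Fin.castAdd h a) +
            ∑ c, C ((if V.card ≤ 1 then (1 : ℂ) else (0 : ℂ)) * (if c ∈ V then 1 else 0)) *
              X (Fin.natAdd h c)))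
        else 0) = Matrix.of fun i j : Fin r => if U i ⊆ w j then (1 : ℂ) else 0 := by
      ext i j
      rw [Matrix.of_apply, Matrix.of_apply]
      by_cases hij : U i ⊆ w j
      · rw [if_pos hij, if_pos hij, hb 0, hb0]
      · rw [if_neg hij, if_neg hij]
    rw [e]
    exact hZ
  have hMX0 : MX.det ≠ 0 := fun e => hdet0 (by rw [e, Polynomial.eval_zero])
  have hbX0 : ∀ j, bX (w j) ≠ 0 := fun j e => by
    have := hb0 (w j)
    rw [e, Polynomial.eval_zero] at this
    exact zero_ne_one this
  -- a non-root of `X · det MX · ∏_j bX (w j)`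
  set p : Polynomial ℂ := Polynomial.X * MX.det * ∏ j, bX (w j) with hp
  have hp0 : p ≠ 0 :=
    mul_ne_zero (mul_ne_zero Polynomial.X_ne_zero hMX0) (Finset.prod_ne_zero_iff.mpr fun j _ => hbX0 j)
  obtain ⟨s, hs⟩ := Infinite.exists_notMem_finset p.roots.toFinset
  have hps : Polynomial.eval s p ≠ 0 := by
    intro e
    exact hs (Multiset.mem_toFinset.mpr ((Polynomial.mem_roots hp0).mpr e))
  rw [hp, Polynomial.eval_mul, Polynomial.eval_mul, Polynomial.eval_X, Polynomial.eval_prod] at hps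
  refine ⟨s, ?_, ?_, ?_⟩
  · exact fun e => hps (by rw [e, zero_mul, zero_mul])
  · rw [hdet s]
    exact fun e => hps (by rw [e, mul_zero, zero_mul])
  · intro j e
    rw [hb s] at e
    exact hps (mul_eq_zero_of_right _ (Finset.prod_eq_zero (Finset.mem_univ j) e))

/-! ## 3. The leave-one-out vectors on arbitrary columns are linearly independent -/

/-- **Invertibility of the leave-one-out matrix on ARBITRARY columns.**  Let `U` be injective and
down-closed, `U i ∈ PT` for all `i`, `s ≠ 0`, and `B̃_s[i,j] = [U i ⊆ w j] · b_s(w j ∖ U i)`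
nonsingular.  Then a combination `c` of the leave-one-out vectors
`(coeff_{y^{w j}} ∏_{V ∈ PT ∖ U i} φ⁰_V)_j` that vanishes at every column is trivial.  Mechanism:
`ℰ = T · B̃_s` with `T[i,i'] = t_{U i}(U i')` (truncated inverses, `coeff_leaveOneOutG`) triangular in
the containment order with nonzero diagonal. -/
theorem leaveOneOut_vecMul_injective (U w : Fin r → Finset (Fin h)) (hU : Function.Injective U)
    (hUdown : ∀ i (S : Finset (Fin h)), S ⊆ U i → ∃ i', U i' = S)
    (PT : Finset (Finset (Fin h))) (hUPT : ∀ i, U i ∈ PT) (s : ℂ) (hs : s ≠ 0)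
    (hBt : (Matrix.of fun i j : Fin r => if U i ⊆ w j then
        coeff (∑ a ∈ (∅ : Finset (Fin h)), Finsupp.single (Fin.castAdd h a) 1 +
            ∑ c ∈ w j \ U i, Finsupp.single (Fin.natAdd h c) 1)
          (∏ V ∈ PT, (C 1 + ∑ a, C ((fun (_ : Fin h) (_ : Finset (Fin h)) => (0 : ℂ)) a V) *
              X (Fin.castAdd h a) +
            ∑ c, C ((if V.card ≤ 1 then (1 : ℂ) else s) * (if c ∈ V then 1 else 0)) * X (Fin.natAdd h c)))
        else 0).det ≠ 0)
    (c : Fin r → ℂ)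
    (hc : ∀ j, ∑ i, c i * coeff (∑ a ∈ (∅ : Finset (Fin h)), Finsupp.single (Fin.castAdd h a) 1 +
            ∑ c ∈ w j, Finsupp.single (Fin.natAdd h c) 1)
          (∏ V ∈ PT.erase (U i), (C 1 + ∑ a, C ((fun (_ : Fin h) (_ : Finset (Fin h)) => (0 : ℂ)) a V) *
              X (Fin.castAdd h a) +
            ∑ c, C ((if V.card ≤ 1 then (1 : ℂ) else s) * (if c ∈ V then 1 else 0)) *
              X (Fin.natAdd h c))) = 0) :
    c = 0 := by
  classical
  set γ : Finset (Fin h) → Fin h → ℂ :=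
    fun V c => (if V.card ≤ 1 then (1 : ℂ) else s) * (if c ∈ V then 1 else 0) with hγ
  have hγsupp : ∀ (V : Finset (Fin h)) (c : Fin h), c ∉ V → γ V c = 0 := by
    intro V c hc
    simp only [hγ, if_neg hc, mul_zero]
  have hγne : ∀ (V : Finset (Fin h)) (c : Fin h), c ∈ V → γ V c ≠ 0 := by
    intro V c hc
    simp only [hγ, if_pos hc, mul_one]
    split_ifs
    · exact one_ne_zero
    · exact hs
  set B : MvPolynomial (Fin (h + h)) ℂ := ∏ V ∈ PT,
    (C 1 + ∑ a, C ((fun (_ : Fin h) (_ : Finset (Fin h)) => (0 : ℂ)) a V) * X (Fin.castAdd h a) +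
      ∑ c, C (γ V c) * X (Fin.natAdd h c)) with hB
  set b : Finset (Fin h) → ℂ := fun W' => coeff (∑ a ∈ (∅ : Finset (Fin h)),
    Finsupp.single (Fin.castAdd h a) 1 + ∑ c ∈ W', Finsupp.single (Fin.natAdd h c) 1) B with hb
  set t : Fin r → Finset (Fin h) → ℂ := fun i X =>
    if X ⊆ U i then (-1 : ℂ) ^ X.card * (X.card.factorial : ℂ) * ∏ c ∈ X, γ (U i) c else 0 with ht
  set d : Finset (Fin h) → ℂ := fun X => ∑ i, c i * t i X with hd
  -- Step 0: `Σ_i c_i ℰ[i,j] = Σ_{X ⊆ w j} b(w j \ X) · d(X)`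
  have hconv : ∀ j, ∑ X ∈ (w j).powerset, b (w j \ X) * d X = 0 := by
    intro j
    rw [← hc j]
    have hrow : ∀ i, c i * coeff (∑ a ∈ (∅ : Finset (Fin h)), Finsupp.single (Fin.castAdd h a) 1 +
            ∑ c ∈ w j, Finsupp.single (Fin.natAdd h c) 1)
          (∏ V ∈ PT.erase (U i), (C 1 + ∑ a, C ((fun (_ : Fin h) (_ : Finset (Fin h)) => (0 : ℂ)) a V) *
              X (Fin.castAdd h a) + ∑ c, C (γ V c) * X (Fin.natAdd h c))) =
        ∑ X ∈ (w j).powerset, c i * (b (w j \ X) * t i X) := by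
      intro i
      rw [coeff_leaveOneOutG γ PT (U i) (hUPT i) (hγsupp (U i)) (w j), Finset.mul_sum]
      refine Finset.sum_congr rfl fun X _ => ?_
      rw [coeff_tinvG]
    rw [Finset.sum_congr rfl fun i _ => hrow i, Finset.sum_comm]
    refine Finset.sum_congr rfl fun X _ => ?_
    simp only [hd, Finset.mul_sum]
    refine Finset.sum_congr rfl fun i _ => ?_
    ring
  -- Step 1: `d` is supported on the image of `U`
  have hdsupp : ∀ X : Finset (Fin h), (¬ ∃ i', U i' = X) → d X = 0 := by
    intro X hX
    simp only [hd]
    refine Finset.sum_eq_zero fun i _ => ?_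
    have hnot : ¬ X ⊆ U i := fun hsub => hX (hUdown i X hsub)
    simp only [ht, if_neg hnot, mul_zero]
  -- Step 2: `d ∘ U` is in the left kernel of `B̃_s`, hence zero
  have hvec : Matrix.vecMul (fun i' => d (U i')) (Matrix.of fun i j : Fin r => if U i ⊆ w j then
        b (w j \ U i) else 0) = 0 := by
    funext j
    rw [Matrix.vecMul, dotProduct]
    simp only [Matrix.of_apply, Pi.zero_apply, mul_ite, mul_zero]
    -- reindex the sum over `i'` as a sum over `X ∈ image U`, then compare with the powerset sum
    have e1 : ∑ i', (if U i' ⊆ w j then d (U i') * b (w j \ U i') else 0) =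
        ∑ X ∈ (Finset.univ : Finset (Fin r)).image U, (if X ⊆ w j then d X * b (w j \ X) else 0) := by
      rw [Finset.sum_image (fun i _ i' _ e => hU e)]
    have e2 : ∑ X ∈ (Finset.univ : Finset (Fin r)).image U, (if X ⊆ w j then d X * b (w j \ X) else 0) =
        ∑ X ∈ ((Finset.univ : Finset (Fin r)).image U).filter (fun X => X ⊆ w j), d X * b (w j \ X) := by
      rw [Finset.sum_filter]
    have e3 : ((Finset.univ : Finset (Fin r)).image U).filter (fun X => X ⊆ w j) =
        (w j).powerset.filter (fun X => ∃ i', U i' = X) := by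
      ext X
      simp only [Finset.mem_filter, Finset.mem_image, Finset.mem_univ, true_and, Finset.mem_powerset]
      tauto
    have e4 : ∑ X ∈ (w j).powerset.filter (fun X => ∃ i', U i' = X), d X * b (w j \ X) =
        ∑ X ∈ (w j).powerset, b (w j \ X) * d X := by
      rw [Finset.sum_filter_of_ne]
      · exact Finset.sum_congr rfl fun X _ => mul_comm _ _
      · intro X _ hne
        by_contra hX
        exact hne (by rw [hdsupp X hX, zero_mul])
    rw [e1, e2, e3, e4]
    exact hconv j
  have hBunit : IsUnit (Matrix.of fun i j : Fin r => if U i ⊆ w j then b (w j \ U i) else 0) :=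
    (Matrix.isUnit_iff_isUnit_det _).mpr (isUnit_iff_ne_zero.mpr hBt)
  have hd0 : ∀ i', d (U i') = 0 := by
    have hinj := Matrix.vecMul_injective_iff_isUnit.mpr hBunit
    have e : (fun i' => d (U i')) = 0 := by
      refine hinj ?_
      beta_reduce
      rw [hvec, Matrix.zero_vecMul]
    intro i'
    exact congr_fun e i'
  -- Step 3: triangularity of the truncated inverses: `c = 0` by downward induction on `|U i'|`
  have hB' : ∀ n : ℕ, ∀ i', h - (U i').card = n → c i' = 0 := by
    intro n
    induction n using Nat.strong_induction_on with
    | _ n ih =>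
      intro i' hn
      have hsum : ∑ i, c i * t i (U i') = 0 := hd0 i'
      rw [← Finset.add_sum_erase _ _ (Finset.mem_univ i')] at hsum
      have hrest : ∑ i ∈ (Finset.univ : Finset (Fin r)).erase i', c i * t i (U i') = 0 := by
        refine Finset.sum_eq_zero fun i hi => ?_
        have hne : i ≠ i' := (Finset.mem_erase.mp hi).1
        by_cases hsub : U i' ⊆ U i
        · have hlt : (U i').card < (U i).card :=
            Finset.card_lt_card (lt_of_le_of_ne hsub (fun e => hne (hU e).symm))
          have hle : (U i).card ≤ h := by simpa using Finset.card_le_univ (U i)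
          rw [ih (h - (U i).card) (by omega) i rfl, zero_mul]
        · simp only [ht, if_neg hsub, mul_zero]
      rw [hrest, add_zero] at hsum
      have htne : t i' (U i') ≠ 0 := by
        simp only [ht, if_pos (subset_refl _)]
        refine mul_ne_zero (mul_ne_zero (pow_ne_zero _ (by norm_num)) ?_) ?_
        · exact_mod_cast (U i').card.factorial_ne_zero
        · exact Finset.prod_ne_zero_iff.mpr fun c hc => hγne (U i') c hc
      exact (mul_eq_zero.mp hsum).resolve_right htne
  funext i'
  exact hB' _ i' rfl

end Summit.ValiantsHypothesis.ValiantsHypothesis.Theorems.BarrierLever.ChowThinAll
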